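import Summits.ResolutionOfSingularities.ResolutionOfSingularities.Theses.CleanCovers
import Summits.ResolutionOfSingularities.ResolutionOfSingularities.Theses.IndSmooth
import Summits.ResolutionOfSingularities.ResolutionOfSingularities.Theses.FrobeniusClosing
import Summits.ResolutionOfSingularities.ResolutionOfSingularities.Theorems.CleanCoversCoverResolutionLocalPatching
import Summits.ResolutionOfSingularities.ResolutionOfSingularities.Theorems.CleanCoversCoverResolutionLocallyResolvable
import Summits.ResolutionOfSingularities.ResolutionOfSingularities.Theorems.CleanCoversCoverResolutionCalibration
import Summits.ResolutionOfSingularities.ResolutionOfSingularities.Theorems.CleanCoversCoverResolutionIffResPerfect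
import Summits.ResolutionOfSingularities.ResolutionOfSingularities.Theorems.CleanCoversCoverResolutionNormalReduction
import HarnessLib

/-!
# Crux `CleanCovers.CoverResolution` (stmt-ResolutionOfSingularities-15104), line `strategy-split`
# v2.2: the FLOOR of the split — `CoverResolution ↔ LurelPerfect ∧ PatchingRelPerfect`

Route `ResolutionOfSingularities/CleanCovers`, line lead continuation seat c2 (2026-08-17).

Line `strategy-split` splits the crux `CoverResolution` (every Kedlaya cover `f : X → ℙⁿ_k`, `k`
perfect of characteristic `p`, has a resolution) into a LOCAL half (local resolution along the
hyperplane at infinity, stub L / L⁰) and a PATCHING half (v2.1: Zariski's two-model patching T of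
proper models over perfect fields). This file records the logically weakest form of that split and
shows that BOTH halves are then statements the programme already carries as items of other routes:

* the local half in its weakest form is RELATIVE LOCAL UNIFORMIZATION OVER PERFECT FIELDS,
  verbatim the route item `IndSmooth.LurelPerfect` (stmt-ResolutionOfSingularities-16086; also the
  antecedent, prime by prime, of `FrobeniusClosing.PatchingRelPerfect`);
* the patching half in its weakest sufficient form is the route item
  `FrobeniusClosing.PatchingRelPerfect` (stmt-ResolutionOfSingularities-16161: for every prime `p`,
  relative local uniformization over perfect fields of characteristic `p` implies resolution of
  every reduced separated scheme of finite type over every perfect field of characteristic `p`),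
  one term shared by eight routes and reduced in the tree to a dimension-4 punctual atom plus a
  dimension-`≥ 5` residual (`Theorems.patchingRelPerfect_of_printed_of_atomDimFour_of_dimGeFive`).

Everything is composition of LANDED lemmas of this line:
`CoverResolution → L` (`boundaryLocalResolution_of_coverResolution`), `L → LocRes_perfect`
(`locallyResolvable_perfect_of_boundaryLocalResolution`, through Kedlaya's theorem, proved in the
tree), `LocRes_perfect → LurelPerfect` (`relLUPerfect_of_locallyResolvablePerfect`, affine models and
centres of valuations), `CoverResolution ↔ ResPerfect` (`coverResolution_iff_resPerfect`, through
the proved route item `KedlayaReduction`), `L⁰ → L` (`boundaryLocalResolution_of_normal`).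

Main statements:
* `coverResolution_iff_lurelPerfect_and_patchingRelPerfect` — **CR ↔ LurelPerfect ∧ PatchingRelPerfect**;
* `coverResolution_iff_boundaryLocalResolutionNormal_and_patchingRelPerfect` — **CR ↔ L⁰ ∧
  PatchingRelPerfect** (the registered skeleton v2.2: the engine's typed output L⁰ for normal
  Kedlaya covers, and the sibling crux verbatim);
* `lurelPerfect_of_boundaryLocalResolutionNormal` — the engine's output L⁰ already proves the item
  `IndSmooth.LurelPerfect`;
* under `PatchingRelPerfect` the four local statements CR, L⁰, LocRes_perfect, LurelPerfect collapse
  (`lurelPerfect_iff_coverResolution_of_patchingRelPerfect`,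
  `locallyResolvablePerfect_iff_coverResolution_of_patchingRelPerfect`).

No named fact is taken as a hypothesis beyond the displayed antecedents; no `sorry`.
-/

set_option linter.dupNamespace false -- mandated namespace of this single-conjunct summit

noncomputable section

namespace Summit.ResolutionOfSingularities.ResolutionOfSingularities.Theorems

open CategoryTheory AlgebraicGeometry TopologicalSpace
open Literature.AlgebraicGeometry.Resolution
open Summit.ResolutionOfSingularities.ResolutionOfSingularities.Theses

/-! ## The crux implies both items -/

/-- **`CoverResolution → LurelPerfect`**: a resolution of every Kedlaya cover gives local resolution
along the hyperplane at infinity (restriction), hence a resolvable open neighbourhood of every point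
of every integral separated finite-type scheme over a perfect field (Kedlaya's theorem), hence
relative local uniformization over perfect fields (uniformize the centre of the valuation on a local
resolution of an affine model). All three steps are landed lemmas of this line.
[cite: Kedlaya2004, Thm. 1; ZariskiSamuel1960, Ch. VI §17] -/
theorem lurelPerfect_of_coverResolution : Summit.ResolutionOfSingularities.ResolutionOfSingularities.Theses.CleanCovers.CoverResolution → Summit.ResolutionOfSingularities.ResolutionOfSingularities.Theses.IndSmooth.LurelPerfect :=
  fun hC => relLUPerfect_of_locallyResolvablePerfect
    (locallyResolvable_perfect_of_boundaryLocalResolution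
      (boundaryLocalResolution_of_coverResolution hC))

/-- **`CoverResolution → PatchingRelPerfect`**: the crux is resolution over perfect fields
(`coverResolution_iff_resPerfect`, through the proved `KedlayaReduction`), which is the CONSEQUENT
of `PatchingRelPerfect` at every prime; its antecedent is not even used. [folklore] -/
theorem patchingRelPerfect_of_coverResolution : Summit.ResolutionOfSingularities.ResolutionOfSingularities.Theses.CleanCovers.CoverResolution → Summit.ResolutionOfSingularities.ResolutionOfSingularities.Theses.FrobeniusClosing.PatchingRelPerfect :=
  fun hC p hp _ => coverResolution_iff_resPerfect.mp hC p hp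

/-! ## Both items imply the crux -/

/-- **`LurelPerfect → PatchingRelPerfect → CoverResolution`**: relative local uniformization over
perfect fields is, prime by prime, the antecedent of `PatchingRelPerfect`, whose consequent —
resolution of reduced separated schemes of finite type over perfect fields of characteristic `p` —
is the crux (`coverResolution_iff_resPerfect`). [folklore] -/
theorem coverResolution_of_lurelPerfect_of_patchingRelPerfect : Summit.ResolutionOfSingularities.ResolutionOfSingularities.Theses.IndSmooth.LurelPerfect → Summit.ResolutionOfSingularities.ResolutionOfSingularities.Theses.FrobeniusClosing.PatchingRelPerfect → Summit.ResolutionOfSingularities.ResolutionOfSingularities.Theses.CleanCovers.CoverResolution :=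
  fun hLU hP => coverResolution_iff_resPerfect.mpr fun p hp =>
    hP p hp (fun k K _ _ _ _ _ => hLU p hp k K)

/-- **The floor of line `strategy-split`: `CoverResolution ↔ LurelPerfect ∧ PatchingRelPerfect`.**
The crux of route `CleanCovers` is EQUIVALENT to the conjunction of two items of other routes: the
target `IndSmooth.LurelPerfect` (stmt-16086, relative local uniformization over perfect fields) and
the crux `FrobeniusClosing.PatchingRelPerfect` (stmt-16161, Zariski patching over perfect fields).
This is Zariski's dichotomy "resolution = local uniformization + patching" over perfect ground
fields, with Kedlaya's normal form absorbed on the local side. [folklore] -/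
theorem coverResolution_iff_lurelPerfect_and_patchingRelPerfect : Summit.ResolutionOfSingularities.ResolutionOfSingularities.Theses.CleanCovers.CoverResolution ↔ Summit.ResolutionOfSingularities.ResolutionOfSingularities.Theses.IndSmooth.LurelPerfect ∧ Summit.ResolutionOfSingularities.ResolutionOfSingularities.Theses.FrobeniusClosing.PatchingRelPerfect :=
  ⟨fun hC => ⟨lurelPerfect_of_coverResolution hC, patchingRelPerfect_of_coverResolution hC⟩,
    fun h => coverResolution_of_lurelPerfect_of_patchingRelPerfect h.1 h.2⟩

/-! ## The engine's typed output L⁰ on the same floor -/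

/-- **`L⁰ → LurelPerfect`**: local resolution along the hyperplane at infinity for NORMAL Kedlaya
covers (the registered stub `stub_boundaryLocalResolutionNormal` of line `strategy-split`, the
cleaning engine's typed output) already proves the item `IndSmooth.LurelPerfect`: normalise
(`boundaryLocalResolution_of_normal`), localise (`locallyResolvable_perfect_of_boundaryLocalResolution`),
uniformize (`relLUPerfect_of_locallyResolvablePerfect`). [cite: Kedlaya2004, Thm. 1] -/
theorem lurelPerfect_of_boundaryLocalResolutionNormal : (∀ p : ℕ, p.Prime → ∀ (k : Type) [Field k] [CharP k p] [PerfectField k] (n : ℕ) (X : AlgebraicGeometry.Scheme.{0}) (f : X ⟶ (Literature.AlgebraicGeometry.Motives.projectiveSpace n k).left), AlgebraicGeometry.IsIntegral X → AlgebraicGeometry.IsFinite f → Function.Surjective f.base → (letI := MvPolynomial.gradedAlgebra (σ := Fin (n + 1)) (R := k); AlgebraicGeometry.Etale (f ∣_ (AlgebraicGeometry.Proj.basicOpen (MvPolynomial.homogeneousSubmodule (Fin (n + 1)) k) (MvPolynomial.X (Fin.last n))))) → (∀ x : X, IsIntegrallyClosed (X.presheaf.stalk x)) → ∀ h : (Literature.AlgebraicGeometry.Motives.projectiveSpace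 n k).left, (letI := MvPolynomial.gradedAlgebra (σ := Fin (n + 1)) (R := k); h ∉ AlgebraicGeometry.Proj.basicOpen (MvPolynomial.homogeneousSubmodule (Fin (n + 1)) k) (MvPolynomial.X (Fin.last n))) → ∃ B : (Literature.AlgebraicGeometry.Motives.projectiveSpace n k).left.Opens, h ∈ B ∧ Literature.AlgebraicGeometry.Resolution.Scheme.HasResolution ((f ⁻¹ᵁ B : X.Opens) : AlgebraicGeometry.Scheme.{0})) → Summit.ResolutionOfSingularities.ResolutionOfSingularities.Theses.IndSmooth.LurelPerfect :=
  fun hL0 => relLUPerfect_of_locallyResolvablePerfect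
    (locallyResolvable_perfect_of_boundaryLocalResolution (boundaryLocalResolution_of_normal hL0))

/-- **Assembly of skeleton v2.2: `L⁰ → PatchingRelPerfect → CoverResolution`.** The engine's output
for normal Kedlaya covers and the sibling crux `FrobeniusClosing.PatchingRelPerfect` give the crux.
[folklore] -/
theorem coverResolution_of_boundaryLocalResolutionNormal_of_patchingRelPerfect : (∀ p : ℕ, p.Prime → ∀ (k : Type) [Field k] [CharP k p] [PerfectField k] (n : ℕ) (X : AlgebraicGeometry.Scheme.{0}) (f : X ⟶ (Literature.AlgebraicGeometry.Motives.projectiveSpace n k).left), AlgebraicGeometry.IsIntegral X → AlgebraicGeometry.IsFinite f → Function.Surjective f.base → (letI := MvPolynomial.gradedAlgebra (σ := Fin (n + 1)) (R := k); AlgebraicGeometry.Etale (f ∣_ (AlgebraicGeometry.Proj.basicOpen (MvPolynomial.homogeneousSubmodule (Fin (n + 1)) k) (MvPolynomial.X (Fin.last n))))) → (∀ x : X, IsIntegrallyClosed (X.presheaf.stalk x)) → ∀ h : (Literature.AlgebraicGeometry.Motives.projectiveSpace n k).left, (letI := MvPolynomial.gradedAlgebra (σ := Fin (n + 1)) (R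 := k); h ∉ AlgebraicGeometry.Proj.basicOpen (MvPolynomial.homogeneousSubmodule (Fin (n + 1)) k) (MvPolynomial.X (Fin.last n))) → ∃ B : (Literature.AlgebraicGeometry.Motives.projectiveSpace n k).left.Opens, h ∈ B ∧ Literature.AlgebraicGeometry.Resolution.Scheme.HasResolution ((f ⁻¹ᵁ B : X.Opens) : AlgebraicGeometry.Scheme.{0})) → Summit.ResolutionOfSingularities.ResolutionOfSingularities.Theses.FrobeniusClosing.PatchingRelPerfect → Summit.ResolutionOfSingularities.ResolutionOfSingularities.Theses.CleanCovers.CoverResolution :=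
  fun hL0 hP => coverResolution_of_lurelPerfect_of_patchingRelPerfect
    (lurelPerfect_of_boundaryLocalResolutionNormal hL0) hP

/-- **`CoverResolution ↔ L⁰ ∧ PatchingRelPerfect`** — the registered skeleton v2.2 of line
`strategy-split` is an equivalence: `→` by restricting a resolution of the cover to `f⁻¹(⊤)`
(`boundaryLocalResolution_of_coverResolution`, normality unused) and
`patchingRelPerfect_of_coverResolution`; `←` is the assembly. [folklore] -/
theorem coverResolution_iff_boundaryLocalResolutionNormal_and_patchingRelPerfect : Summit.ResolutionOfSingularities.ResolutionOfSingularities.Theses.CleanCovers.CoverResolution ↔ (∀ p : ℕ, p.Prime → ∀ (k : Type) [Field k] [CharP k p] [PerfectField k] (n : ℕ) (X : AlgebraicGeometry.Scheme.{0}) (f : X ⟶ (Literature.AlgebraicGeometry.Motives.projectiveSpace n k).left), AlgebraicGeometry.IsIntegral X → AlgebraicGeometry.IsFinite f → Function.Surjective f.base → (letI := MvPolynomial.gradedAlgebra (σ := Fin (n + 1)) (R := k); AlgebraicGeometry.Etale (f ∣_ (AlgebraicGeometry.Proj.basicOpen (MvPolynomial.homogeneousSubmodule (Fin (n + 1)) k)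 (MvPolynomial.X (Fin.last n))))) → (∀ x : X, IsIntegrallyClosed (X.presheaf.stalk x)) → ∀ h : (Literature.AlgebraicGeometry.Motives.projectiveSpace n k).left, (letI := MvPolynomial.gradedAlgebra (σ := Fin (n + 1)) (R := k); h ∉ AlgebraicGeometry.Proj.basicOpen (MvPolynomial.homogeneousSubmodule (Fin (n + 1)) k) (MvPolynomial.X (Fin.last n))) → ∃ B : (Literature.AlgebraicGeometry.Motives.projectiveSpace n k).left.Opens, h ∈ B ∧ Literature.AlgebraicGeometry.Resolution.Scheme.HasResolution ((f ⁻¹ᵁ B : X.Opens) : AlgebraicGeometry.Scheme.{0})) ∧ Summit.ResolutionOfSingularities.ResolutionOfSingularities.Theses.FrobeniusClosing.PatchingRelPerfect := by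
  refine ⟨fun hC => ⟨?_, patchingRelPerfect_of_coverResolution hC⟩,
    fun h => coverResolution_of_boundaryLocalResolutionNormal_of_patchingRelPerfect h.1 h.2⟩
  intro p hp k _ _ _ n X f hint hfin hsurj het _ h hh
  exact boundaryLocalResolution_of_coverResolution hC p hp k n X f hint hfin hsurj het h hh

/-! ## Under `PatchingRelPerfect` the local statements collapse -/

/-- Under `PatchingRelPerfect`, relative local uniformization over perfect fields is equivalent to
the crux (hence to resolution over perfect fields). [folklore] -/
theorem lurelPerfect_iff_coverResolution_of_patchingRelPerfect : Summit.ResolutionOfSingularities.ResolutionOfSingularities.Theses.FrobeniusClosing.PatchingRelPerfect → (Summit.ResolutionOfSingularities.ResolutionOfSingularities.Theses.IndSmooth.LurelPerfect ↔ Summit.ResolutionOfSingularities.ResolutionOfSingularities.Theses.CleanCovers.CoverResolution) :=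
  fun hP => ⟨fun hLU => coverResolution_of_lurelPerfect_of_patchingRelPerfect hLU hP,
    lurelPerfect_of_coverResolution⟩

/-- Under `PatchingRelPerfect`, pointwise local resolvability of integral separated finite-type
schemes over perfect fields (LocRes_perfect) is equivalent to the crux: `→` through
`relLUPerfect_of_locallyResolvablePerfect`, `←` through L
(`boundaryLocalResolution_of_coverResolution`, `locallyResolvable_perfect_of_boundaryLocalResolution`).
[folklore] -/
theorem locallyResolvablePerfect_iff_coverResolution_of_patchingRelPerfect : Summit.ResolutionOfSingularities.ResolutionOfSingularities.Theses.FrobeniusClosing.PatchingRelPerfect → ((∀ p : ℕ, p.Prime → ∀ (k : Type) [Field k] [CharP k p] [PerfectField k] (X : AlgebraicGeometry.Scheme.{0}) (g : X ⟶ AlgebraicGeometry.Spec (.of k)), AlgebraicGeometry.IsSeparated g → AlgebraicGeometry.LocallyOfFiniteType g → AlgebraicGeometry.QuasiCompact g → AlgebraicGeometry.IsIntegral X → ∀ x : X, ∃ U : X.Opens, x ∈ U ∧ Literature.AlgebraicGeometry.Resolution.Scheme.HasResolution (U : AlgebraicGeometry.Scheme.{0})) ↔ Summit.ResolutionOfSingularities.ResolutionOfSingularities.Theses.CleanCovers.CoverResolution)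 :=
  fun hP => ⟨fun hLoc => coverResolution_of_lurelPerfect_of_patchingRelPerfect
      (relLUPerfect_of_locallyResolvablePerfect hLoc) hP,
    fun hC => locallyResolvable_perfect_of_boundaryLocalResolution
      (boundaryLocalResolution_of_coverResolution hC)⟩

end Summit.ResolutionOfSingularities.ResolutionOfSingularities.Theorems

end
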